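import Mathlib.FieldTheory.Galois.Infinite
import Mathlib.FieldTheory.LinearDisjoint
import Literature.NumberTheory.GaloisRepresentations.AbsGaloisOuterConj
import HarnessLib

/-!
# Images of finite quotients of `Γ_{F'}` on `Γ_L` for `L` linearly disjoint from the fixed field
# of the kernel (glue G2/G2b of `stub_pointAutomorphicT`, line thorne-minimal-lift)

Crux `Summit.Langlands.Langlands.Theses.PicardMuOrdinary.MuOrdinaryFamilyRT`, line
thorne-minimal-lift.  In the proof of `stub_pointAutomorphicT` a soluble CM extension `L/F'` is
produced (CHT 2008, 4.1.2) with `D ⊗_{F'} L` a field for a chosen finite `D/F'`; taking for `D` the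
fixed field of the (open) kernel of `φ = r̄ ∘ res_{K → F'}` (a residual representation with finite
image) one needs that `φ` keeps its image on `Γ_L`:

* `finiteDimensional_fixedField_ker` (G2b): the fixed field `D = F̄'^{ker φ}` of an open subgroup
  of `Γ_{F'} = Gal(F̄'/F')` is finite over `F'` (infinite Galois theory,
  `InfiniteGalois.isOpen_iff_finite`, `F̄'/F'` being Galois in characteristic `0`);
* `range_comp_absGaloisRestrict_eq_of_isField` (G2): if `D ⊗_{F'} L` is a field then
  `(φ ∘ res_{F' → L})(Γ_L) = φ(Γ_{F'})`.  Proof: `res(Γ_L) = Gal(F̄'/e(L))` for the tree's embedding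
  `e : L → F̄'` (`mem_range_absGaloisRestrict_iff_smul_absEmbedding`); `D ⊗ L` a field makes `D`
  and `e(L)` linearly disjoint, so `D ∩ e(L) = F'` (Mathlib
  `IntermediateField.LinearDisjoint.of_isField'`, `.inf_eq_bot`); the subgroup
  `S = Gal(F̄'/e(L)) · ker φ` is open, hence closed, hence `S = Gal(F̄'/F̄'^S)`
  (`InfiniteGalois.fixingSubgroup_fixedField`) with `F̄'^S ⊆ e(L) ∩ D = F'`, so `S = Γ_{F'}`:
  every `g ∈ Γ_{F'}` is `res(σ) · u` with `φ(u) = 1`.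

General lemmas (any Galois extension `K/k` with the Krull topology):
`fixingSubgroup_sup_eq_top_of_inf_eq_bot`, `exists_mem_fixingSubgroup_mul_eq_of_inf_eq_bot`,
`finiteDimensional_fixedField_of_isOpen`.

References: J. Neukirch, *Algebraic Number Theory* (1999), Ch. IV §1 (1.1)–(1.2) (Krull topology,
closed subgroups and subextensions); N. Bourbaki, *Algèbre*, Ch. V §10 (linearly disjoint
extensions); L. Clozel, M. Harris, R. Taylor, *Automorphy for some l-adic lifts of automorphic mod l
Galois representations*, Publ. Math. IHÉS 108 (2008), Lemma 4.1.2 and its use in §4.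
-/

set_option linter.dupNamespace false -- `Summit.Langlands.Langlands.…` is the problem's namespace

namespace Summit.Langlands.Langlands.Cruxes.MuOrdinaryFamilyRT.ThorneMinimalLift

open scoped NumberField Polynomial Matrix Classical TensorProduct
open Field IsDedekindDomain Polynomial
open Literature.NumberTheory.GaloisRepresentations Literature.NumberTheory.Automorphic

noncomputable section

/-! ## 1. Infinite Galois theory: open subgroups and disjoint subextensions -/

section InfiniteGalois

variable {k K : Type*} [Field k] [Field K] [Algebra k K]

/-- For `K/k` Galois, `U ≤ Gal(K/k)` open and `E` an intermediate field with `K^U ∩ E = k`, the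
subgroup generated by `Gal(K/E)` and `U` is everything: it is open, hence closed, hence the fixing
subgroup of its fixed field `K^{Gal(K/E)} ∩ K^U ⊆ E ∩ K^U = k`.
Ref: Neukirch, *Algebraic Number Theory* (1999), Ch. IV (1.2). [folklore] -/
theorem fixingSubgroup_sup_eq_top_of_inf_eq_bot [IsGalois k K] (U : Subgroup (K ≃ₐ[k] K))
    (hU : IsOpen (U : Set (K ≃ₐ[k] K))) (E : IntermediateField k K)
    (h : IntermediateField.fixedField U ⊓ E = ⊥) : E.fixingSubgroup ⊔ U = ⊤ := by
  set S : Subgroup (K ≃ₐ[k] K) := E.fixingSubgroup ⊔ U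
  have hSopen : IsOpen (S : Set (K ≃ₐ[k] K)) := Subgroup.isOpen_mono le_sup_right hU
  have hSclosed : IsClosed (S : Set (K ≃ₐ[k] K)) := Subgroup.isClosed_of_isOpen S hSopen
  have hfix : (IntermediateField.fixedField S).fixingSubgroup = S :=
    InfiniteGalois.fixingSubgroup_fixedField ⟨S, hSclosed⟩
  have hbot : IntermediateField.fixedField S = ⊥ := by
    rw [eq_bot_iff, ← h]
    refine le_inf (IntermediateField.fixedField_le le_sup_right) ?_
    calc IntermediateField.fixedField S ≤ IntermediateField.fixedField E.fixingSubgroup :=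
          IntermediateField.fixedField_le le_sup_left
      _ = E := InfiniteGalois.fixedField_fixingSubgroup E
  rw [← hfix, hbot, IntermediateField.fixingSubgroup_bot]

/-- For `K/k` Galois, `U ⊴ Gal(K/k)` open normal and `E` an intermediate field with `K^U ∩ E = k`,
every `g ∈ Gal(K/k)` is `a · u` with `a ∈ Gal(K/E)` and `u ∈ U` (i.e. `Gal(K/E) → Gal(K/k)/U` is
onto).  Ref: Neukirch, *Algebraic Number Theory* (1999), Ch. IV (1.2). [folklore] -/
theorem exists_mem_fixingSubgroup_mul_eq_of_inf_eq_bot [IsGalois k K] (U : Subgroup (K ≃ₐ[k] K))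
    [hUn : U.Normal] (hU : IsOpen (U : Set (K ≃ₐ[k] K))) (E : IntermediateField k K)
    (h : IntermediateField.fixedField U ⊓ E = ⊥) (g : K ≃ₐ[k] K) :
    ∃ a ∈ E.fixingSubgroup, ∃ u ∈ U, a * u = g := by
  have hg : g ∈ ((E.fixingSubgroup ⊔ U : Subgroup (K ≃ₐ[k] K)) : Set (K ≃ₐ[k] K)) := by
    rw [fixingSubgroup_sup_eq_top_of_inf_eq_bot U hU E h]
    exact Subgroup.mem_top g
  rw [Subgroup.mul_normal] at hg
  exact Set.mem_mul.mp hg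

/-- For `K/k` Galois, the fixed field of an open subgroup `U ≤ Gal(K/k)` is finite over `k`
(`Gal(K/K^U) ⊇ U` is open; `InfiniteGalois.isOpen_iff_finite`).
Ref: Neukirch, *Algebraic Number Theory* (1999), Ch. IV (1.2). [folklore] -/
theorem finiteDimensional_fixedField_of_isOpen [IsGalois k K] (U : Subgroup (K ≃ₐ[k] K))
    (hU : IsOpen (U : Set (K ≃ₐ[k] K))) :
    FiniteDimensional k (IntermediateField.fixedField U) := by
  rw [← InfiniteGalois.isOpen_iff_finite]
  exact Subgroup.isOpen_mono
    ((IntermediateField.le_iff_le U (IntermediateField.fixedField U)).mp le_rfl) hU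

end InfiniteGalois

/-! ## 2. Registered glue G2b and G2 -/

/-- **G2b.**  The fixed field in `F̄'` of an open subgroup `ker φ` of `Γ_{F'}` (e.g. the kernel of a
continuous representation with finite image) is a finite extension of the number field `F'`
(`F̄'/F'` is Galois in characteristic `0`; `finiteDimensional_fixedField_of_isOpen`). -/
theorem finiteDimensional_fixedField_ker : ∀ (F' : Type) [Field F'] [NumberField F'] {G : Type} [Group G] (φ : absoluteGaloisGroup F' →* G), IsOpen ((φ.ker : Subgroup (absoluteGaloisGroup F')) : Set (absoluteGaloisGroup F')) → FiniteDimensional F' ↥(IntermediateField.fixedField φ.ker) := by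
  intro F' _ _ G _ φ hopen
  exact finiteDimensional_fixedField_of_isOpen (k := F') (K := AlgebraicClosure F') φ.ker hopen

/-- **G2.**  Let `φ : Γ_{F'} → G` have open kernel with fixed field `D = F̄'^{ker φ}`, and let
`L/F'` be a finite extension with `D ⊗_{F'} L` a field.  Then `φ` has the same image on `Γ_L`
(through the tree's restriction `res : Γ_L → Γ_{F'}`): `(φ ∘ res)(Γ_L) = φ(Γ_{F'})`.  Indeed
`res(Γ_L) = Gal(F̄'/e(L))`, `D` and `e(L)` are linearly disjoint so `D ∩ e(L) = F'`, and then
`Gal(F̄'/e(L)) · ker φ = Γ_{F'}` (`exists_mem_fixingSubgroup_mul_eq_of_inf_eq_bot`). -/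
theorem range_comp_absGaloisRestrict_eq_of_isField : ∀ (F' : Type) [Field F'] [NumberField F'] (L : Type) [Field L] [NumberField L] [Algebra F' L] {G : Type} [Group G] (φ : absoluteGaloisGroup F' →* G), IsOpen ((φ.ker : Subgroup (absoluteGaloisGroup F')) : Set (absoluteGaloisGroup F')) → IsField (↥(IntermediateField.fixedField φ.ker) ⊗[F'] L) → (φ.comp (absGaloisRestrict F' L).toMonoidHom).range = φ.range := by
  intro F' _ _ L _ _ _ G _ φ hopen hfield
  -- `D ∩ e(L) = F'`
  set D : IntermediateField F' (AlgebraicClosure F') := IntermediateField.fixedField φ.ker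
  set E : IntermediateField F' (AlgebraicClosure F') := (absEmbedding F' L).fieldRange with hE
  have hdisj : D ⊓ E = ⊥ := by
    have h :=
      (IntermediateField.LinearDisjoint.of_isField' hfield D.val (absEmbedding F' L)).inf_eq_bot
    rwa [IntermediateField.fieldRange_val] at h
  refine le_antisymm ?_ ?_
  · rintro _ ⟨σ, rfl⟩
    exact ⟨absGaloisRestrict F' L σ, rfl⟩
  · rintro _ ⟨g, rfl⟩
    -- `g = a u` with `a ∈ Gal(F̄'/e(L)) = res(Γ_L)` and `φ u = 1`
    obtain ⟨a, ha, u, hu, hg⟩ : ∃ a : absoluteGaloisGroup F', a ∈ E.fixingSubgroup ∧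
        ∃ u : absoluteGaloisGroup F', u ∈ φ.ker ∧ a * u = g :=
      exists_mem_fixingSubgroup_mul_eq_of_inf_eq_bot (k := F') (K := AlgebraicClosure F')
        (hUn := MonoidHom.normal_ker φ) φ.ker hopen E hdisj g
    have ha' : a ∈ (absGaloisRestrict F' L).range := by
      rw [mem_range_absGaloisRestrict_iff_smul_absEmbedding]
      intro x
      exact (IntermediateField.mem_fixingSubgroup_iff E a).mp ha _ (by simp [hE])
    obtain ⟨σ, hσ⟩ := ha'
    refine ⟨σ, ?_⟩
    have hu' : φ u = 1 := hu
    change φ ((absGaloisRestrict F' L).toMonoidHom σ) = φ g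
    rw [hσ, ← hg, map_mul, hu', mul_one]

end

end Summit.Langlands.Langlands.Cruxes.MuOrdinaryFamilyRT.ThorneMinimalLift
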